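import Mathlib
import Summits.Ventures.PercRepro2.TypedRootMonoBPath

/-!
# (ROOT-MONO-b) beside a type-2 path `a₁ – o – b` (blind cell PercRepro2, night-3 g18, 2026-08-28;
`proofs/NIGHT3-CERT.md` §27.13) — the `b`-twin of `TypedRootMonoBPath.lean`

With `f = {a₁, o}` and `g = {o, b}` typed edges of type `2`, adding a NEW edge `e = {a₁, b}` of
type `1` never decreases the typed base of `K₃` (`rootMonoB_of_o_path`): some copy carries both
`f`, `g` and has `o, b ∈ C(a₁)`; opening `e` there changes nothing, opening it elsewhere makes a
second such copy — and two copies with `o, b` together in `C(a₁)` make the symmetrised kernel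
nonnegative (g14's `KBsym_st_nonneg_of_two`). The first class of (ROOT-MONO-b)
(`CovForm.RootMonoB`) proved beyond typed degree `≤ 1`. Own work; standard axioms.
-/

namespace Summit.Ventures.PercRepro2

open UnionCluster

namespace CovForm

namespace Triangle

open OneTyped Untouched CoincRoot TypedRed PositiveOB

section Main

open Classical

variable {V : Type*} {E : Type*} [Fintype E] [DecidableEq E] {R : Type*} [Field R]
  [LinearOrder R] [IsStrictOrderedRing R]
variable (ends : E → Sym2 V) (o a₁ a₂ a₃ b : V)

omit [Fintype E] [DecidableEq E] [LinearOrder R] [IsStrictOrderedRing R] in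
/-- A copy carrying `f = {a₁, o}` and `g = {o, b}` has `o, b ∈ C(a₁)`. -/
lemma conn_of_both_bo {f g : E} (hf : ends f = s(a₁, o)) (hg : ends g = s(o, b)) (u : Config E)
    (huf : u f = true) (hug : u g = true) : Conn ends u a₁ o ∧ Conn ends u a₁ b := by
  have co : Conn ends u a₁ o := conn_of_openAdj ⟨f, huf, hf⟩
  have cb : Conn ends u o b := conn_of_openAdj ⟨g, hug, hg⟩
  exact ⟨co, conn_trans co cb⟩

omit [Fintype E] [LinearOrder R] [IsStrictOrderedRing R] in
/-- A copy carrying `f` or `g` has `o, b ∈ C(a₁)` once `e = {a₁, b}` is opened. -/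
lemma conn_of_update_of_one_bo {e f g : E} (he : ends e = s(a₁, b)) (hf : ends f = s(a₁, o))
    (hg : ends g = s(o, b)) (u : Config E) (h : u f = true ∨ u g = true) :
    Conn ends (Function.update u e true) a₁ o ∧ Conn ends (Function.update u e true) a₁ b := by
  have ce : Conn ends (Function.update u e true) a₁ b :=
    conn_of_openAdj ⟨e, Function.update_self e true u, he⟩
  refine ⟨?_, ce⟩
  rcases h with h | h
  · exact conn_mono (le_update_true u e) (conn_of_openAdj ⟨f, h, hf⟩)
  · exact conn_trans ce (conn_symm (conn_mono (le_update_true u e) (conn_of_openAdj ⟨g, h, hg⟩)))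

omit [Fintype E] [LinearOrder R] [IsStrictOrderedRing R] in
/-- **The core pointwise inequality** (`b`-twin), the copy `x` carrying both `f` and `g`: the three placements
of the new edge `e` sum to at least the term without `e`. -/
lemma three_placements_ge_b {e f g : E} (he : ends e = s(a₁, b)) (hf : ends f = s(a₁, o))
    (hg : ends g = s(o, b)) (x y w : Config E) (hxf : x f = true) (hxg : x g = true)
    (hf2 : (x f).toNat + (y f).toNat + (w f).toNat = 2)
    (hg2 : (x g).toNat + (y g).toNat + (w g).toNat = 2) :
    KBsym (st ends o a₁ a₂ a₃ b x) (st ends o a₁ a₂ a₃ b y) (st ends o a₁ a₂ a₃ b w) ≤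
      KBsym (st ends o a₁ a₂ a₃ b (Function.update x e true)) (st ends o a₁ a₂ a₃ b y)
        (st ends o a₁ a₂ a₃ b w) +
      KBsym (st ends o a₁ a₂ a₃ b x) (st ends o a₁ a₂ a₃ b (Function.update y e true))
        (st ends o a₁ a₂ a₃ b w) +
      KBsym (st ends o a₁ a₂ a₃ b x) (st ends o a₁ a₂ a₃ b y)
        (st ends o a₁ a₂ a₃ b (Function.update w e true)) := by
  obtain ⟨hxo, hxb⟩ := conn_of_both_bo ends o a₁ b hf hg x hxf hxg
  have h1 : st ends o a₁ a₂ a₃ b (Function.update x e true) = st ends o a₁ a₂ a₃ b x :=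
    TwoTyped.st_update_true_of_conn ends o a₁ a₂ a₃ b he x hxb
  have h2 : 0 ≤ KBsym (st ends o a₁ a₂ a₃ b x) (st ends o a₁ a₂ a₃ b (Function.update y e true))
      (st ends o a₁ a₂ a₃ b w) := by
    cases hyf : y f <;> cases hyg : y g
    · have hw : w f = true ∧ w g = true := by
        rw [hxf, hyf] at hf2; rw [hxg, hyg] at hg2
        cases hwf : w f <;> cases hwg : w g <;> simp_all
      obtain ⟨hwo, hwb⟩ := conn_of_both_bo ends o a₁ b hf hg w hw.1 hw.2
      exact KBsym_st_nonneg_of_two_ob_13 ends o a₁ a₂ a₃ b x _ w hxo hxb hwo hwb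
    · obtain ⟨hyo, hyb⟩ := conn_of_update_of_one_bo ends o a₁ b he hf hg y (Or.inr hyg)
      exact KBsym_st_nonneg_of_two_ob_12 ends o a₁ a₂ a₃ b x _ w hxo hxb hyo hyb
    · obtain ⟨hyo, hyb⟩ := conn_of_update_of_one_bo ends o a₁ b he hf hg y (Or.inl hyf)
      exact KBsym_st_nonneg_of_two_ob_12 ends o a₁ a₂ a₃ b x _ w hxo hxb hyo hyb
    · obtain ⟨hyo, hyb⟩ := conn_of_update_of_one_bo ends o a₁ b he hf hg y (Or.inl hyf)
      exact KBsym_st_nonneg_of_two_ob_12 ends o a₁ a₂ a₃ b x _ w hxo hxb hyo hyb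
  have h3 : 0 ≤ KBsym (st ends o a₁ a₂ a₃ b x) (st ends o a₁ a₂ a₃ b y)
      (st ends o a₁ a₂ a₃ b (Function.update w e true)) := by
    cases hwf : w f <;> cases hwg : w g
    · have hy : y f = true ∧ y g = true := by
        rw [hxf, hwf] at hf2; rw [hxg, hwg] at hg2
        cases hyf : y f <;> cases hyg : y g <;> simp_all
      obtain ⟨hyo, hyb⟩ := conn_of_both_bo ends o a₁ b hf hg y hy.1 hy.2
      exact KBsym_st_nonneg_of_two_ob_12 ends o a₁ a₂ a₃ b x y _ hxo hxb hyo hyb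
    · obtain ⟨hwo, hwb⟩ := conn_of_update_of_one_bo ends o a₁ b he hf hg w (Or.inr hwg)
      exact KBsym_st_nonneg_of_two_ob_13 ends o a₁ a₂ a₃ b x y _ hxo hxb hwo hwb
    · obtain ⟨hwo, hwb⟩ := conn_of_update_of_one_bo ends o a₁ b he hf hg w (Or.inl hwf)
      exact KBsym_st_nonneg_of_two_ob_13 ends o a₁ a₂ a₃ b x y _ hxo hxb hwo hwb
    · obtain ⟨hwo, hwb⟩ := conn_of_update_of_one_bo ends o a₁ b he hf hg w (Or.inl hwf)
      exact KBsym_st_nonneg_of_two_ob_13 ends o a₁ a₂ a₃ b x y _ hxo hxb hwo hwb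
  rw [h1]
  linarith

omit [Fintype E] [LinearOrder R] [IsStrictOrderedRing R] in
/-- The pointwise inequality for any triple on the support. -/
lemma three_placements_ge_b' {e f g : E} (he : ends e = s(a₁, b)) (hf : ends f = s(a₁, o))
    (hg : ends g = s(o, b)) (x y w : Config E)
    (hf2 : (x f).toNat + (y f).toNat + (w f).toNat = 2)
    (hg2 : (x g).toNat + (y g).toNat + (w g).toNat = 2) :
    KBsym (st ends o a₁ a₂ a₃ b x) (st ends o a₁ a₂ a₃ b y) (st ends o a₁ a₂ a₃ b w) ≤
      KBsym (st ends o a₁ a₂ a₃ b (Function.update x e true)) (st ends o a₁ a₂ a₃ b y)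
        (st ends o a₁ a₂ a₃ b w) +
      KBsym (st ends o a₁ a₂ a₃ b x) (st ends o a₁ a₂ a₃ b (Function.update y e true))
        (st ends o a₁ a₂ a₃ b w) +
      KBsym (st ends o a₁ a₂ a₃ b x) (st ends o a₁ a₂ a₃ b y)
        (st ends o a₁ a₂ a₃ b (Function.update w e true)) := by
  rcases some_copy_both hf2 hg2 with ⟨hxf, hxg⟩ | ⟨hyf, hyg⟩ | ⟨hwf, hwg⟩
  · exact three_placements_ge_b ends o a₁ a₂ a₃ b he hf hg x y w hxf hxg hf2 hg2
  · have h := three_placements_ge_b ends o a₁ a₂ a₃ b he hf hg y x w hyf hyg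
      (by rw [← hf2]; ring) (by rw [← hg2]; ring)
    rw [KBsym_comm_left (st ends o a₁ a₂ a₃ b (Function.update y e true)),
      KBsym_comm_left (st ends o a₁ a₂ a₃ b y) (st ends o a₁ a₂ a₃ b (Function.update x e true)),
      KBsym_comm_left (st ends o a₁ a₂ a₃ b y) (st ends o a₁ a₂ a₃ b x)
        (st ends o a₁ a₂ a₃ b (Function.update w e true)),
      KBsym_comm_left (st ends o a₁ a₂ a₃ b y) (st ends o a₁ a₂ a₃ b x)] at h
    linarith
  · have h := three_placements_ge_b ends o a₁ a₂ a₃ b he hf hg w y x hwf hwg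
      (by rw [← hf2]; ring) (by rw [← hg2]; ring)
    have s : ∀ p q r : St, KBsym p q r = KBsym r q p := by
      intro p q r
      rw [KBsym_comm_left, KBsym_comm_right, KBsym_comm_left]
    rw [s (st ends o a₁ a₂ a₃ b (Function.update w e true)),
      s (st ends o a₁ a₂ a₃ b w) (st ends o a₁ a₂ a₃ b (Function.update y e true)),
      s (st ends o a₁ a₂ a₃ b w) (st ends o a₁ a₂ a₃ b y)
        (st ends o a₁ a₂ a₃ b (Function.update x e true)),
      s (st ends o a₁ a₂ a₃ b w) (st ends o a₁ a₂ a₃ b y)] at h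
    linarith

/-- **(ROOT-MONO-b) beside a type-2 path `a₁ – o – b`**: with `f = {a₁, o}` and `g = {o, b}` in `F`
of type `2`, adding the new edge `e = {a₁, b}` of type `1` never decreases the typed base. -/
theorem rootMonoB_of_o_path {e f g : E} (he : ends e = s(a₁, b)) (hf : ends f = s(a₁, o))
    (hg : ends g = s(o, b)) (F : Finset E) (heF : e ∉ F) (hfF : f ∈ F) (hgF : g ∈ F)
    (z : Config E) (hze : z e = false) (τ : E → ℕ) (hτ : ∀ e' ∈ F, τ e' = 1 ∨ τ e' = 2)
    (hτf : τ f = 2) (hτg : τ g = 2) :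
    typedCount F z τ (K3 ends o a₁ a₂ a₃ b : Config E → Config E → Config E → R) ≤
      typedCount (insert e F) z (Function.update τ e 1) (K3 ends o a₁ a₂ a₃ b) := by
  have hτ' : ∀ e' ∈ insert e F, Function.update τ e 1 e' = 1 ∨ Function.update τ e 1 e' = 2 := by
    intro e' he'
    rcases Finset.mem_insert.1 he' with rfl | he'
    · left; exact Function.update_self _ _ _
    · rw [Function.update_of_ne (fun h => heF (by rw [← h]; exact he'))]
      exact hτ e' he'
  have hcτ : ∀ K : Config E → Config E → Config E → R,
      typedCount F z (Function.update τ e 1) K = typedCount F z τ K := fun K =>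
    typedCount_congr_τ F z (fun e' he' => Function.update_of_ne (fun h => heF (by rw [← h]; exact he')) _ _) K
  have h6L := six_mul_typedCount_KBsym'' (R := R) ends o a₁ a₂ a₃ b (insert e F) z
    (Function.update τ e 1) hτ'
  have h6R := six_mul_typedCount_KBsym'' (R := R) ends o a₁ a₂ a₃ b F z τ hτ
  set KS : Config E → Config E → Config E → R := fun x y w =>
    ((KBsym (st ends o a₁ a₂ a₃ b x) (st ends o a₁ a₂ a₃ b y) (st ends o a₁ a₂ a₃ b w) : ℤ) : R)
    with hKS
  have hsplit := typedCount_split (insert e F) e (Finset.mem_insert_self e F) z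
    (Function.update τ e 1) KS
  have hz : Function.update z e false = z := by
    rw [← hze]; exact Function.update_eq_self e z
  rw [Function.update_self, Finset.erase_insert heF, hz, sum_bool3_one_rp, hcτ, hcτ, hcτ,
    ← TypedRed.typedCount_add, ← TypedRed.typedCount_add] at hsplit
  -- the pointwise inequality on the support of the right count, as a nonnegative difference
  have hpt : 0 ≤ typedCount F z τ (fun x y w =>
      (KS (Function.update x e true) (Function.update y e false) (Function.update w e false) +
      KS (Function.update x e false) (Function.update y e true) (Function.update w e false) +
      KS (Function.update x e false) (Function.update y e false) (Function.update w e true)) +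
      -KS x y w) := by
    refine typedCount_nonneg_of_nonneg_on_support F z τ fun x y w hoff hτ'' => ?_
    have hx : Function.update x e false = x := by
      have h : x e = false := (hoff e heF).1.trans hze
      rw [← h]; exact Function.update_eq_self e x
    have hy : Function.update y e false = y := by
      have h : y e = false := (hoff e heF).2.1.trans hze
      rw [← h]; exact Function.update_eq_self e y
    have hw : Function.update w e false = w := by
      have h : w e = false := (hoff e heF).2.2.trans hze
      rw [← h]; exact Function.update_eq_self e w
    rw [hx, hy, hw]
    have hf2 := hτ'' f hfF
    have hg2 := hτ'' g hgF
    rw [hτf] at hf2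
    rw [hτg] at hg2
    unfold openCount at hf2 hg2
    have := three_placements_ge_b' ends o a₁ a₂ a₃ b he hf hg x y w hf2 hg2
    simp only [hKS]
    have h' : ((KBsym (st ends o a₁ a₂ a₃ b x) (st ends o a₁ a₂ a₃ b y)
        (st ends o a₁ a₂ a₃ b w) : ℤ) : R) ≤
        ((KBsym (st ends o a₁ a₂ a₃ b (Function.update x e true)) (st ends o a₁ a₂ a₃ b y)
          (st ends o a₁ a₂ a₃ b w) : ℤ) : R) +
        ((KBsym (st ends o a₁ a₂ a₃ b x) (st ends o a₁ a₂ a₃ b (Function.update y e true))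
          (st ends o a₁ a₂ a₃ b w) : ℤ) : R) +
        ((KBsym (st ends o a₁ a₂ a₃ b x) (st ends o a₁ a₂ a₃ b y)
          (st ends o a₁ a₂ a₃ b (Function.update w e true)) : ℤ) : R) := by
      exact_mod_cast this
    linarith
  rw [TypedRed.typedCount_add, TypedA3.typedCount_neg'] at hpt
  rw [← hsplit, ← h6L, ← h6R] at hpt
  linarith

end Main

end Triangle

end CovForm

end Summit.Ventures.PercRepro2
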